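import Summits.BirchSwinnertonDyer.Rank1Residual.GaloisImage.KolyvaginPrimeSmallImageTorsion
import Summits.BirchSwinnertonDyer.Rank1Residual.X4.KimShaLength
import HarnessLib

/-!
# The cyclic-level Kurihara vocabulary DEGENERATES at a prime of irreducible, non-surjective image:
# `IsCyclicKolyvaginLevel W p n → n = 1`, `∂^{(i)}(δ̃) = ⊤ (i ≥ 1)`, `∂^{(∞)}(δ̃) = ∂^{(0)}(δ̃)`, and
# the image-free transplant of Kim's clause (6) says `p ∤ #Ш(E/ℚ)`
# (cell `b2b-bsdres`, lane CLASS-CLOSURE, seat cc-typer-1 = typer of record of class O8 and author of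
# the JOINT small-image target text O8 / N2 / N3; team n1011, image strand)

HONEST FRAMING (run/shared/lean/b2b/bsd-rank1-residual/, verbatim in every file): the goal of the
cell is to DELETE the COMBINATION-SHAPED residual classes of the Birch–Swinnerton-Dyer formula for
ALL analytic-rank `≤ 1` elliptic curves over `ℚ` — "full BSD formula for every rank `≤ 1` curve in
class `C`" assembled STRICTLY from published theorems — so that the rank-`≤ 1` remainder becomes
exactly the CONSTRUCTION-SHAPED classes, which are TYPED (missing-input `Prop`s), NOT attempted.
This is not "finishing BSD". Lane CLASS-CLOSURE (coordinator ruling 2026-08-21T04:07:19Z): research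
routes; no claim beyond stated classes; census output = EVIDENCE, never a Literature fact.
THEOREMS ONLY (no definition, no named fact, nothing booked, no label or mark changed): kernel
statements about the cell's OWN typed vocabulary (`IsCyclicKolyvaginLevel`, `kuriharaPartial`,
`kuriharaPartialInfty`, `kuriharaVanishingOrder`, p249101) and typed conjecture items
(`X4.KimShaLengthAt`, `X4.KimShaLengthRankZeroAt`, p249774) on the pairs `(E, p)` with `E[p]`
IRREDUCIBLE and `ρ̄_{E,p}` NOT SURJECTIVE — class O8
(`ClassX4 W p ∧ ¬ Surj W p`), and equally N2 (X10b, `3Ns`/`3Nn`), N3 (X9, `5Ns`/`7Ns`/`5S4`), the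
`3Nn` rows of X8/X7: every hypothesis below is `Irr W p ∧ ¬ Surj W p`, nothing else about the class.

## What this file proves (the FORMULATE note of `class-closure/O8/STATEMENT.md` v1 §2.3, now a theorem)

The glue it asked for EXISTS in the tree (additive-p3, `GaloisImage/KolyvaginPrimeSmallImageTorsion.lean`:
`sq_le_natCard_torsion_intModel_of_isKolyvaginPrime` — at `irr(p) ∧ ¬surj(p)` every Kolyvagin prime
`ℓ ∈ 𝒫₁(E,p)` has `p² ≤ #(E₀ mod ℓ)(𝔽_ℓ)[p]`, because the Frobenius at `ℓ` (determinant `ℓ ≡ 1`,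
trace `a_ℓ ≡ 2 (mod p)`) is unipotent, and a proper irreducible subgroup of `GL₂(𝔽_p)` with
surjective determinant contains no element of order `p`, Serre 1972 §2.4 Prop. 15 read backwards,
so `Frob_ℓ = 1` and `E[p] ↪ Ẽ(𝔽_ℓ)` additively). On it:

* §1 `eq_one_of_isCyclicKolyvaginLevel_of_irr_of_not_surj`: **the set of cyclic Kolyvagin levels of
  an `irr ∧ ¬surj` pair is `{1}`** (`IsCyclicKolyvaginLevel W p n ↔ n = 1`).
* §2 the `∂`-vocabulary of Kim 2026 / Mazur–Rubin over those levels DEGENERATES: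
  `kuriharaPartial W p f i = ⊤` for `i ≠ 0` (an infimum over no level), hence
  `kuriharaPartialInfty W p f = kuriharaPartial W p f 0 = kuriharaDivIndex W p f 1`
  (`∂^{(∞)}(δ̃) = ∂^{(0)}(δ̃) = ord_p δ̃_1`), and `ord(δ̃) ∈ {0, ⊤}`.
* §3 **the image-free transplant of Kim's clause (6)** — the predicate `X4.KimShaLengthAt W p f`
  (cc-typer-1's VERBATIM CORE of Kim, Amer. J. Math. 148 (2026) Thm. 1.8 (6), which carries NO image
  binder: the image hypothesis lives in the binder-shaped items) — READS, at an `irr ∧ ¬surj` pair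
  with `δ̃_1 ≠ 0` (analytic rank `0`): `ord_p #Ш(E/ℚ)(p) = 0`; with `Ш` finite, `p ∤ #Ш(E/ℚ)`. The
  same for the BSD-currency item `X4.KimShaLengthRankZeroAt W p D.f` under the period transfer, and,
  through the fact-free bookkeeping `X4.bsdp_iff_eq_tamagawa_of_rankZero_witness`, the Miller reading
  "`BSD(E,p) ⟺ ord_p (L(E,1)/Ω(E)) = ord_p ∏_ℓ c_ℓ(E)`" — no room for `Ш` in the `p`-part.
* SEQUEL `Additive/O8KimTransplantRefutation.lean` (same seat): the REFUTATION shape (`Ш` finite,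
  `p ∣ #Ш(E/ℚ)` ⟹ `¬ X4.KimShaLengthAt`; per certificate from ONE native `p`-descent line
  `Sel^{(p)}(E/ℚ) ≠ 0` in rank `0`), the O8 corollaries under `ClassX4 W p ∧ ¬ Surj W p`, and the
  vacuity of the binder-shaped item `Additive.KimRankZeroShaLengthAt W p` (first binder `Surj W p`).

Consequence for the lane (numbers = EVIDENCE from `class-closure/O8/pairs.tsv`, cc-eng-1 `obsanat`
0.2.0, T4-countersigned 1 726 pairs): "N11's statement with the image hypothesis dropped" is NOT a
candidate statement for O8 — it predicts `p ∤ #Ш` on every rank-`0` O8 row, against BSD's `#Ш_an`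
with `ord_p #Ш_an = 2` on 28 rank-`0` rows (`p = 3`: 17 of image `3Nn`, 5 of `3Ns`; `p = 5`: 2 `Nn`,
3 `Ns`, 1 `S4`); any Kurihara-number statement for O8 / N2 / N3 must live on NON-cyclic levels
(Kim's full `𝒩₁`, where `δ̃_n` is defined — tree: `Kato.IsKolyvaginProduct`, `kuriharaNumber` — but
Mazur–Rubin's Thm. 2.1 input "`T/(Fr_ℓ − 1)T` cyclic" fails and nothing is in print). This is the
kernel half of the JOINT small-image ideation target (`class-closure/O8/STATEMENT.md` §4 = team
n1011 `cells/n1011/O8-IDEATION.md` §A): ONE missing input for O8 / N2 / N3 = an integral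
Kolyvagin-system / main-conjecture divisibility for `T_pE` WITHOUT the useful element. Nothing is
booked; O8, N2, N3 stay OPEN; labels unchanged.

References: J.-P. Serre, Invent. Math. 15 (1972) §2.4 Prop. 15 [Serre1972]; C.-H. Kim, Amer. J.
Math. 148 (2026) 79–129 = arXiv:2203.12159v4, §1.2.2, §1.4.3–1.4.4, §1.5.1, Thm. 1.9 (= journal 1.8)
(6), Thm. 2.1 (Mazur–Rubin: "`T/(Fr_ℓ − 1)T` is a cyclic `ℤ_p`-module") [Kim2022StructureSelmer];
B. Mazur, K. Rubin, Mem. AMS 799 (2004) §3.5, §5.2 [MazurRubin2004]; R. L. Miller, LMS J. Comput.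
Math. 14 (2011) Def. 1.1 [Miller2011LMS]; cell files class-closure/O8/STATEMENT.md (v1 §2.3, v2),
cells/n1011/O8-IDEATION.md §A, cells/n1011/O8-SUBPARTITION.md.
-/

noncomputable section

open scoped Classical MatrixGroups ModularForm

open CongruenceSubgroup WeierstrassCurve Literature.NumberTheory.EllipticCurves
  Literature.NumberTheory.EllipticCurves.ModularForms
  Literature.NumberTheory.EllipticCurves.Rank1Residual
  Literature.NumberTheory.EllipticCurves.Rank1Residual.Typed

namespace Summit.BirchSwinnertonDyer.Rank1Residual.GaloisImage

/-! ### §1 The cyclic Kolyvagin levels of an `irr ∧ ¬surj` pair: only `n = 1` -/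

section Levels

variable (W : WeierstrassCurve ℚ) [W.IsElliptic] [W.IsGloballyMinimal] (p : ℕ) [hp : Fact p.Prime]

/-- **At a prime `p` with `E[p]` irreducible and `ρ̄_{E,p}` not surjective, the only cyclic
Kolyvagin level is `n = 1`.** A cyclic level `n ∈ 𝒩₁(E,p)` (`IsCyclicKolyvaginLevel W p n`) asks
`#(E₀ mod ℓ)(𝔽_ℓ)[p] ≤ p` at every prime `ℓ ∣ n`, while every such `ℓ` is a Kolyvagin prime and has
`p² ≤ #(E₀ mod ℓ)(𝔽_ℓ)[p]` (`sq_le_natCard_torsion_intModel_of_isKolyvaginPrime`: the Frobenius at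
`ℓ` is trivial on `E[p]`, Serre's Prop. 15 read backwards); `p < p²`, so `n` has no prime factor.
The level-set form of Kim's Thm. 2.1 hypothesis "`T/(Fr_ℓ − 1)T` is a cyclic `ℤ_p`-module".
[cite: Serre1972, §2.4 Prop. 15] [cite: Kim2022StructureSelmer, §1.2.2 and Thm. 2.1 (PDF p. 12)] -/
theorem eq_one_of_isCyclicKolyvaginLevel_of_irr_of_not_surj (hirr : Irr W p) (hns : ¬ Surj W p)
    {n : ℕ} (hn : IsCyclicKolyvaginLevel W p n) : n = 1 := by
  obtain ⟨hprod, hcyc⟩ := hn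
  have hp2 : 2 ≤ p := hp.out.two_le
  have hpp : p < p ^ 2 := by nlinarith
  have hempty : n.primeFactors = ∅ := by
    by_contra hne
    obtain ⟨ℓ, hℓ⟩ := Finset.nonempty_iff_ne_empty.mpr hne
    have hK : Kato.IsKolyvaginPrime W p 1 ℓ := hprod.2 ℓ hℓ
    haveI : Fact ℓ.Prime := ⟨hK.prime⟩
    have h2 := sq_le_natCard_torsion_intModel_of_isKolyvaginPrime W p hirr hns hK
    have h3 := hcyc ℓ (Nat.dvd_of_mem_primeFactors hℓ)
    omega
  rcases Nat.primeFactors_eq_empty.mp hempty with h0 | h1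
  · exact absurd h0 hprod.ne_zero
  · exact h1

/-- **The cyclic level set is `{1}`** at an `irr ∧ ¬surj` pair: `IsCyclicKolyvaginLevel W p n ↔ n = 1`
(`1` is always a level, `isCyclicKolyvaginLevel_one`).
[cite: Serre1972, §2.4 Prop. 15] [cite: Kim2022StructureSelmer, §1.2.2 and §1.4.2 (PDF pp. 5, 7)] -/
theorem isCyclicKolyvaginLevel_iff_eq_one_of_irr_of_not_surj (hirr : Irr W p) (hns : ¬ Surj W p)
    (n : ℕ) : IsCyclicKolyvaginLevel W p n ↔ n = 1 := by
  refine ⟨eq_one_of_isCyclicKolyvaginLevel_of_irr_of_not_surj W p hirr hns, ?_⟩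
  rintro rfl
  exact isCyclicKolyvaginLevel_one W p

end Levels

/-! ### §2 The `∂`-vocabulary over cyclic levels degenerates -/

section Partial

variable (W : WeierstrassCurve ℚ) [W.IsElliptic] [W.IsGloballyMinimal] (p : ℕ) [hp : Fact p.Prime]
  {N : ℕ} (f : CuspForm (Gamma0 N) 2)

/-- **`∂^{(i)}(δ̃) = ⊤` for every `i ≥ 1`** at an `irr ∧ ¬surj` pair: `kuriharaPartial W p f i` is the
infimum of the divisibility indices over the cyclic levels with `i` prime factors, and there is none
(§1). (Kim §1.5.1 / Def. 2.13: "for every `n ∈ 𝒩_1` with `ν(n) = i`" — an empty condition.)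
[cite: Kim2022StructureSelmer, §1.5.1 (PDF p. 7), Def. 2.13 (PDF p. 14)] [cite: Serre1972, §2.4 Prop. 15] -/
theorem kuriharaPartial_eq_top_of_irr_of_not_surj (hirr : Irr W p) (hns : ¬ Surj W p) {i : ℕ}
    (hi : i ≠ 0) : kuriharaPartial W p f i = ⊤ := by
  rw [kuriharaPartial_def]
  refine iInf_eq_top.mpr fun n => iInf_eq_top.mpr fun hn => iInf_eq_top.mpr fun hcard => ?_
  exfalso
  have h1 := eq_one_of_isCyclicKolyvaginLevel_of_irr_of_not_surj W p hirr hns hn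
  subst h1
  rw [Nat.primeFactors_one, Finset.card_empty] at hcard
  exact hi hcard.symm

/-- **`∂^{(∞)}(δ̃) = ∂^{(0)}(δ̃)`** at an `irr ∧ ¬surj` pair (`∂^{(∞)} = min_i ∂^{(i)}` and
`∂^{(i)} = ⊤` for `i ≥ 1`). [cite: Kim2022StructureSelmer, §1.5.1 (PDF p. 7)] [cite: Serre1972, §2.4 Prop. 15] -/
theorem kuriharaPartialInfty_eq_kuriharaPartial_zero_of_irr_of_not_surj (hirr : Irr W p)
    (hns : ¬ Surj W p) : kuriharaPartialInfty W p f = kuriharaPartial W p f 0 := by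
  rw [kuriharaPartialInfty]
  refine le_antisymm (iInf_le _ 0) (le_iInf fun i => ?_)
  rcases eq_or_ne i 0 with rfl | hi
  · exact le_rfl
  · rw [kuriharaPartial_eq_top_of_irr_of_not_surj W p f hirr hns hi]
    exact le_top

/-- **`∂^{(∞)}(δ̃) = ord_p δ̃_1`** (the divisibility index of the level-`1` Kurihara number
`δ_1 = [0]⁺_f`) at an `irr ∧ ¬surj` pair: `kuriharaPartialInfty W p f = kuriharaDivIndex W p f 1`
(`kuriharaPartial_zero`). So `∂^{(∞)}` carries no Tamagawa / Kolyvagin-system information there.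
[cite: Kim2022StructureSelmer, §1.4.3 and §1.5.1 (PDF p. 7)] [cite: Serre1972, §2.4 Prop. 15] -/
theorem kuriharaPartialInfty_eq_kuriharaDivIndex_one_of_irr_of_not_surj (hirr : Irr W p)
    (hns : ¬ Surj W p) : kuriharaPartialInfty W p f = kuriharaDivIndex W p f 1 := by
  rw [kuriharaPartialInfty_eq_kuriharaPartial_zero_of_irr_of_not_surj W p f hirr hns,
    kuriharaPartial_zero]

/-- **`ord(δ̃) = ⊤` when `δ̃_1` vanishes** at an `irr ∧ ¬surj` pair: the only cyclic level is `1`,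
so if `kuriharaDivIndex W p f 1 = ⊤` (no non-zero member) the vanishing order is `⊤` ("`∞`", Kim
§1.4.4); otherwise it is `0` (`kuriharaVanishingOrder_eq_zero_of`). No positive finite value occurs.
[cite: Kim2022StructureSelmer, §1.4.4 (PDF p. 7)] [cite: Serre1972, §2.4 Prop. 15] -/
theorem kuriharaVanishingOrder_eq_top_of_irr_of_not_surj (hirr : Irr W p) (hns : ¬ Surj W p)
    (h1 : kuriharaDivIndex W p f 1 = ⊤) : kuriharaVanishingOrder W p f = ⊤ := by
  rw [kuriharaVanishingOrder]
  refine iInf_eq_top.mpr fun n => iInf_eq_top.mpr fun hn => iInf_eq_top.mpr fun hlt => ?_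
  exfalso
  obtain rfl := eq_one_of_isCyclicKolyvaginLevel_of_irr_of_not_surj W p hirr hns hn
  rw [h1] at hlt
  exact lt_irrefl _ hlt

/-- **`ord(δ̃) ∈ {0, ⊤}`** at an `irr ∧ ¬surj` pair (dichotomy on `δ̃_1`).
[cite: Kim2022StructureSelmer, §1.4.4 (PDF p. 7)] [cite: Serre1972, §2.4 Prop. 15] -/
theorem kuriharaVanishingOrder_eq_zero_or_eq_top_of_irr_of_not_surj (hirr : Irr W p)
    (hns : ¬ Surj W p) :
    kuriharaVanishingOrder W p f = 0 ∨ kuriharaVanishingOrder W p f = ⊤ := by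
  rcases eq_or_ne (kuriharaDivIndex W p f 1) ⊤ with h1 | h1
  · exact Or.inr (kuriharaVanishingOrder_eq_top_of_irr_of_not_surj W p f hirr hns h1)
  · exact Or.inl (kuriharaVanishingOrder_eq_zero_of W p f (lt_top_iff_ne_top.mpr h1))

end Partial

/-! ### §3 The image-free transplant of Kim's clause (6) reads `ord_p #Ш(E/ℚ)(p) = 0` -/

section Transplant

variable (W : WeierstrassCurve ℚ) [W.IsElliptic] [W.IsGloballyMinimal] (p : ℕ) [hp : Fact p.Prime]
  {N : ℕ} (f : CuspForm (Gamma0 N) 2)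

/-- **Kim's clause (6) with the image binder dropped, at an `irr ∧ ¬surj` pair with `δ̃_1 ≠ 0`,
says `ord_p #Ш(E/ℚ)(p) = 0`.** `X4.KimShaLengthAt W p f` is "`ord(δ̃) = r ⇒ ∂^{(∞)} = d ∈ ℕ ∧
∂^{(r)} = ord_p #Ш(p) + d`"; here `ord(δ̃) = 0` (`kuriharaDivIndex W p f 1 < ⊤`), and
`∂^{(∞)} = ∂^{(0)}` (§2), so `d = ord_p #Ш(p) + d`. (When `Ш[p^∞]` is infinite `Nat.card = 0` and the
conclusion is the junk `ord_p 0 = 0`; the finite reading is the next theorem.)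
[cite: Kim2022StructureSelmer, Thm. 1.9 (6) (PDF p. 8), §1.5.1 (PDF p. 7)] [cite: Serre1972, §2.4 Prop. 15] -/
theorem padicValNat_sha_eq_zero_of_kimShaLengthAt_of_irr_of_not_surj (hirr : Irr W p)
    (hns : ¬ Surj W p) (h6 : X4.KimShaLengthAt W p f) (h1 : kuriharaDivIndex W p f 1 < ⊤) :
    padicValNat p (Nat.card (AddCommGroup.primaryComponent W.sha p)) = 0 := by
  obtain ⟨d, hd, h0⟩ := h6 0 (kuriharaVanishingOrder_eq_zero_of W p f h1)
  rw [← kuriharaPartialInfty_eq_kuriharaPartial_zero_of_irr_of_not_surj W p f hirr hns, hd] at h0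
  have h : d = padicValNat p (Nat.card (AddCommGroup.primaryComponent W.sha p)) + d := by
    exact_mod_cast h0
  omega

/-- **… with `Ш(E/ℚ)` finite: `p ∤ #Ш(E/ℚ)`** (`ord_p #Ш(p) = ord_p #Ш`,
`padicValNat_card_addPrimaryComponent`; `#Ш ≥ 1`).
[cite: Kim2022StructureSelmer, Thm. 1.9 (6) (PDF p. 8)] [cite: Serre1972, §2.4 Prop. 15] -/
theorem not_dvd_shaOrder_of_kimShaLengthAt_of_irr_of_not_surj (hirr : Irr W p) (hns : ¬ Surj W p)
    (h6 : X4.KimShaLengthAt W p f) (h1 : kuriharaDivIndex W p f 1 < ⊤) (hfin : Finite W.sha) :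
    ¬ p ∣ W.shaOrder := by
  have h := padicValNat_sha_eq_zero_of_kimShaLengthAt_of_irr_of_not_surj W p f hirr hns h6 h1
  haveI : Finite W.sha := hfin
  rw [padicValNat_card_addPrimaryComponent (A := W.sha) p] at h
  have hpos : 0 < W.shaOrder := W.shaOrder_pos hfin
  intro hdvd
  rcases padicValNat.eq_zero_iff.mp h with h' | h' | h'
  · exact hp.out.one_lt.ne' h'
  · exact hpos.ne' (by unfold WeierstrassCurve.shaOrder; exact h')
  · exact h' (by unfold WeierstrassCurve.shaOrder at hdvd; exact hdvd)

/-- In analytic rank `0` the hypothesis `δ̃_1 ≠ 0` is automatic for the newform of `W` at an odd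
`p` with `E[p]` irreducible: `[0]⁺_f = L(E,1)/Ω⁺_f ≠ 0` is `p`-integral, so
`kuriharaDivIndex W p D.f 1 = ord_p [0]⁺_f < ⊤` (`kuriharaDivIndex_one_eq`). Hence: **clause (6),
image binder dropped, at an `irr ∧ ¬surj` pair with `L(E,1) ≠ 0` and `Ш` finite ⟹ `p ∤ #Ш(E/ℚ)`.**
[cite: Kim2022StructureSelmer, Thm. 1.9 (6) (PDF p. 8), §1.4.3 (PDF p. 7)] [cite: Serre1972, §2.4 Prop. 15] -/
theorem not_dvd_shaOrder_of_kimShaLengthAt_of_rankZero_of_irr_of_not_surj (hp2 : p ≠ 2)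
    (hirr : Irr W p) (hns : ¬ Surj W p) (hL : W.entireLFunction 1 ≠ 0) (hfin : Finite W.sha)
    {N : ℕ} [NeZero N] (D : ModularParametrizationData W N) (h6 : X4.KimShaLengthAt W p D.f) :
    ¬ p ∣ W.shaOrder := by
  have hint : ¬ p ∣ (ratPlusSymbol D.f 0).den :=
    not_dvd_den_of_norm_ratCast_le_one
      (D.isNewformOf.norm_ratPlusSymbol_le_one (x := 0) hp2 hirr (by simp))
  have hne : ratPlusSymbol D.f 0 ≠ 0 := by
    intro h0
    apply hL
    rw [D.isNewformOf.entireLFunction_one_eq, h0]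
    simp
  refine not_dvd_shaOrder_of_kimShaLengthAt_of_irr_of_not_surj W p D.f hirr hns h6 ?_ hfin
  rw [kuriharaDivIndex_one_eq W p D.f hint hne]
  exact ENat.coe_lt_top _

omit [W.IsElliptic] [W.IsGloballyMinimal] in
/-- A rational `p`-adic unit has valuation `0` (the period-transfer binder `|u|_p = 1` read on
valuations). [folklore] -/
private theorem padicValRat_eq_zero_of_norm_eq_one {u : ℚ} (hu : ‖(u : ℚ_[p])‖ = 1) :
    padicValRat p u = 0 := by
  have hu0 : (u : ℚ_[p]) ≠ 0 := by
    intro h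
    rw [h, norm_zero] at hu
    exact zero_ne_one hu
  rw [Padic.norm_eq_zpow_neg_valuation hu0, Padic.valuation_ratCast] at hu
  have hp1 : (1 : ℝ) < (p : ℝ) := by exact_mod_cast hp.out.one_lt
  have h := (zpow_eq_one_iff_right₀ (zero_le_one.trans hp1.le) hp1.ne').mp hu
  linarith

/-- **The BSD-currency item degenerates the same way.** `X4.KimShaLengthRankZeroAt W p D.f`
("`L(E,1)/Ω(W) = q`, `∂^{(∞)}(δ̃) = d`, `ord_p q = ord_p #Ш(p) + d`") at an `irr ∧ ¬surj` pair, `p`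
odd, `L(E,1) ≠ 0`, under the period transfer `Ω(W) = u·Ω⁺_f`, `|u|_p = 1`: `∂^{(∞)} = ord_p [0]⁺_f`
(§2 + `kuriharaDivIndex_one_eq`) and `q = [0]⁺_f/u` (`IsNewformOf.entireLFunction_one_eq`), so
`ord_p q = d` and `ord_p #Ш(E/ℚ)(p) = 0`; the witness `q` is returned with `ord_p q = d`.
[cite: Kim2022StructureSelmer, Thm. 1.9 (6) (PDF p. 8), §1.4.3 and §1.5.1 (PDF p. 7)]
[cite: Serre1972, §2.4 Prop. 15] -/
theorem padicValNat_sha_eq_zero_of_kimShaLengthRankZeroAt_of_irr_of_not_surj (hp2 : p ≠ 2)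
    (hirr : Irr W p) (hns : ¬ Surj W p) (hL : W.entireLFunction 1 ≠ 0)
    {N : ℕ} [NeZero N] (D : ModularParametrizationData W N)
    (hper : ∃ u : ℚ, ‖(u : ℚ_[p])‖ = 1 ∧ W.realPeriodRat = u * plusPeriod D.f)
    (h6 : X4.KimShaLengthRankZeroAt W p D.f) :
    ∃ (q : ℚ) (d : ℕ), W.entireLFunction 1 / (W.realPeriodRat : ℂ) = (q : ℂ) ∧
      kuriharaPartialInfty W p D.f = d ∧ padicValRat p q = d ∧
      padicValNat p (Nat.card (AddCommGroup.primaryComponent W.sha p)) = 0 := by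
  obtain ⟨q, d, hq, hd, hval⟩ := h6
  -- `p`-integrality and non-vanishing of `[0]⁺_f`
  have hint : ¬ p ∣ (ratPlusSymbol D.f 0).den :=
    not_dvd_den_of_norm_ratCast_le_one
      (D.isNewformOf.norm_ratPlusSymbol_le_one (x := 0) hp2 hirr (by simp))
  have hLeq := D.isNewformOf.entireLFunction_one_eq
  have hne : ratPlusSymbol D.f 0 ≠ 0 := by
    intro h0
    apply hL
    rw [hLeq, h0]
    simp
  -- `∂^{(∞)} = ord_p [0]⁺_f`
  have hd' := hd
  rw [kuriharaPartialInfty_eq_kuriharaDivIndex_one_of_irr_of_not_surj W p D.f hirr hns,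
    kuriharaDivIndex_one_eq W p D.f hint hne] at hd'
  have hdnat : (padicValRat p (ratPlusSymbol D.f 0)).toNat = d := by exact_mod_cast hd'
  have hv0 : 0 ≤ padicValRat p (ratPlusSymbol D.f 0) := by
    unfold padicValRat
    rw [padicValNat.eq_zero_of_not_dvd hint]
    simp
  have hvsym : padicValRat p (ratPlusSymbol D.f 0) = d := by
    rw [← hdnat, Int.toNat_of_nonneg hv0]
  -- the period transfer: `q = [0]⁺_f / u`, `ord_p u = 0`
  obtain ⟨u, hu, hΩ⟩ := hper
  have hu0 : u ≠ 0 := by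
    rintro rfl
    rw [Rat.cast_zero, norm_zero] at hu
    exact zero_ne_one hu
  have hΩf : 0 < plusPeriod D.f :=
    IsNewform0.plusPeriod_pos_holds D.isNewformOf.1 D.isNewformOf.coeffField_eq_bot
  have hq' : W.entireLFunction 1 / (W.realPeriodRat : ℂ) = ((ratPlusSymbol D.f 0 / u : ℚ) : ℂ) := by
    rw [hLeq, hΩ]
    have hu' : (u : ℂ) ≠ 0 := by exact_mod_cast hu0
    have hΩf' : ((plusPeriod D.f : ℝ) : ℂ) ≠ 0 := by exact_mod_cast hΩf.ne'
    push_cast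
    field_simp
  have hqq : q = ratPlusSymbol D.f 0 / u := by exact_mod_cast hq.symm.trans hq'
  have hvq : padicValRat p q = d := by
    rw [hqq, padicValRat.div hne hu0, padicValRat_eq_zero_of_norm_eq_one p hu, sub_zero, hvsym]
  refine ⟨q, d, hq, hd, hvq, ?_⟩
  have h : (d : ℤ) = (padicValNat p (Nat.card (AddCommGroup.primaryComponent W.sha p)) : ℤ) + d :=
    hvq.symm.trans hval
  omega

/-- **Miller reading: under the transplant, `BSD(E,p) ⟺ ord_p (L(E,1)/Ω(E)) = ord_p ∏_ℓ c_ℓ(E)`**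
— "no room for `Ш` in the `p`-part". At an `irr ∧ ¬surj` pair (`p` odd, `L(E,1) ≠ 0`,
`rank E(ℚ) = r_an`, `Ш` finite, period transfer) granted `X4.KimShaLengthRankZeroAt W p D.f`: the
witness has `ord_p q = d` and `ord_p #Ш(p) = 0` (previous theorem), and the fact-free bookkeeping
`X4.bsdp_iff_eq_tamagawa_of_rankZero_witness` gives `BSDp W p ⟺ d = ord_p ∏ c_ℓ`. Since
`#Ш_an = q·#E(ℚ)²_tors/∏ c_ℓ` with `p ∤ #E(ℚ)_tors` (`E[p]` irreducible), this is "`BSD(E,p) ⟺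
ord_p #Ш_an = 0`": the EVIDENCE count of `class-closure/O8/STATEMENT.md` §2.3 (28 rank-`0` O8 rows
with `ord_p #Ш_an = 2`) is where transplant ∧ `BSD(E,p)` is contradictory. Fact-free; nothing booked.
[cite: Kim2022StructureSelmer, Thm. 1.9 (6) (PDF p. 8)] [cite: Miller2011LMS, Def. 1.1]
[cite: Serre1972, §2.4 Prop. 15] -/
theorem bsdp_iff_padicValRat_eq_tamagawa_of_kimShaLengthRankZeroAt_of_irr_of_not_surj
    (hp2 : p ≠ 2) (hirr : Irr W p) (hns : ¬ Surj W p)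
    (hmw : W.mordellWeilRank = W.analyticRank) (hfin : Finite W.sha) (hL : W.entireLFunction 1 ≠ 0)
    {N : ℕ} [NeZero N] (D : ModularParametrizationData W N)
    (hper : ∃ u : ℚ, ‖(u : ℚ_[p])‖ = 1 ∧ W.realPeriodRat = u * plusPeriod D.f)
    (h6 : X4.KimShaLengthRankZeroAt W p D.f) :
    ∃ q : ℚ, W.entireLFunction 1 / (W.realPeriodRat : ℂ) = (q : ℂ) ∧ ¬ p ∣ W.shaOrder ∧
      (BSDp W p ↔ padicValRat p q = padicValNat p W.tamagawaProduct) := by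
  obtain ⟨q, d, hq, -, hvq, hsha⟩ :=
    padicValNat_sha_eq_zero_of_kimShaLengthRankZeroAt_of_irr_of_not_surj W p hp2 hirr hns hL D hper h6
  have hval : padicValRat p q =
      (padicValNat p (Nat.card (AddCommGroup.primaryComponent W.sha p)) : ℤ) + d := by
    rw [hsha, hvq, Nat.cast_zero, zero_add]
  have hiff := X4.bsdp_iff_eq_tamagawa_of_rankZero_witness W p hmw hfin hL hirr hq hval
  refine ⟨q, hq, ?_, ?_⟩
  · -- `p ∤ #Ш`
    haveI : Finite W.sha := hfin
    have h := hsha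
    rw [padicValNat_card_addPrimaryComponent (A := W.sha) p] at h
    have hpos : 0 < W.shaOrder := W.shaOrder_pos hfin
    intro hdvd
    rcases padicValNat.eq_zero_iff.mp h with h' | h' | h'
    · exact hp.out.one_lt.ne' h'
    · exact hpos.ne' (by unfold WeierstrassCurve.shaOrder; exact h')
    · exact h' (by unfold WeierstrassCurve.shaOrder at hdvd; exact hdvd)
  · rw [hiff]
    constructor
    · intro hd
      rw [hvq, hd]
    · intro h
      exact_mod_cast hvq.symm.trans h

end Transplant

end Summit.BirchSwinnertonDyer.Rank1Residual.GaloisImage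

end
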